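import Mathlib
import Summits.Schanuel.Schanuel.Theorems.RigidCoreMinimalCounterexampleInAclHitSetZeroInBox
import Summits.Schanuel.Schanuel.Theorems.RigidCoreMinimalCounterexampleInAclHitSetRecursion

/-!
# Zeros of continuous functions in closed rational boxes of `ℂᵏ`, inside first-order arithmetic
# (crux stmt-Schanuel-0969 `RigidCore.MinimalCounterexampleInAcl`, line kernel-arithmetic-selection, stub `stub_existsZeroInBox_pi`)

`--supports stmt-Schanuel-0969`; the `k`-dimensional port of `…HitSetZeroInBox.lean` (which is the case of ONE complex
variable), needed in the corank `≥ 2` sector where the moving block of a mate has several complex coordinates.  As there,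
statements about ZEROS OF CONTINUOUS FUNCTIONS IN CLOSED RATIONAL BOXES are made first-order over `ℤ`:

* `exists_zero_in_box_pi_iff` (analysis): a continuous `g ≥ 0` on `Fin k → ℂ` has a zero in the closed rational box
  `∏ⱼ [lo₁ⱼ, hi₁ⱼ] × [lo₂ⱼ, hi₂ⱼ]` iff for every `n` some GAUSSIAN-RATIONAL point `q` of the box has `g q < 1/(n+1)`
  (compactness of the box one way; density of `ℚ[i]ᵏ ∩ box` in the box and continuity the other);
* `exists_int_tuple_eq`: finitely many Gaussian rationals over ONE common positive denominator;
* `ringDefinable_setOf_existsZeroInBox_pi` (general position): if the values of `g_v` at the test tuples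
  `((aⱼ + bⱼ i)/c)ⱼ` form a ring-definable real family in `(v, a, b, c)` (in the sense of `…HitSetBoxArith.lean`:
  ring-definable strict lower rational cut) and the box data `lo_re, hi_re, lo_im, hi_im` (corner numerators, per
  coordinate) and `den` (ONE common denominator) are ring-definable integer functions of `v`, then
  `{v | 0 < den v ∧ ∃ z ∈ box_v, g_v z = 0}` is ring-definable;
* the registered `Fin`-parameter form `stub_existsZeroInBox_pi`.

References: K. Weihrauch, *Computable Analysis* (2000), §6.3 (zero sets of continuous functions); H. Rogers, *Theory of
Recursive Functions and Effective Computability* (1967), §15.1.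
-/

-- the summit namespace `Summit.Schanuel.Schanuel.…` repeats a component by design (D-0022)
set_option linter.dupNamespace false

open Set FirstOrder FirstOrder.Language Filter Topology

namespace Summit.Schanuel.Schanuel.Cruxes.MinimalCounterexampleInAcl.KernelArithmeticSelection

open Literature.ModelTheory.ExponentialFields

/-! ## Analysis: zeros in a closed rational box of `ℂᵏ` through Gaussian-rational test tuples -/

/-- **Zeros in a box of `ℂᵏ` through test points.**  A continuous non-negative `g : (Fin k → ℂ) → ℝ` vanishes somewhere
in the closed rational box `∏ⱼ [lo₁ⱼ, hi₁ⱼ] × [lo₂ⱼ, hi₂ⱼ]` iff for every `n` some Gaussian-rational point of the box has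
`g < 1/(n+1)` (⇒: continuity at the zero and density, coordinatewise, in the sup metric; ⇐: the box is compact, a
subsequence of the test points converges to a zero). [folklore] -/
theorem exists_zero_in_box_pi_iff {k : ℕ} {g : (Fin k → ℂ) → ℝ} (hg : Continuous g) (hg0 : ∀ z, 0 ≤ g z)
    (lo₁ hi₁ lo₂ hi₂ : Fin k → ℚ) :
    (∃ z : Fin k → ℂ, (∀ j, (lo₁ j : ℝ) ≤ (z j).re ∧ (z j).re ≤ hi₁ j ∧ (lo₂ j : ℝ) ≤ (z j).im ∧ (z j).im ≤ hi₂ j) ∧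
        g z = 0) ↔
      ∀ n : ℕ, ∃ q₁ q₂ : Fin k → ℚ, (∀ j, lo₁ j ≤ q₁ j ∧ q₁ j ≤ hi₁ j ∧ lo₂ j ≤ q₂ j ∧ q₂ j ≤ hi₂ j) ∧
        g (fun j => ⟨q₁ j, q₂ j⟩) < 1 / (n + 1) := by
  constructor
  · rintro ⟨z, hz, hz0⟩ n
    obtain ⟨δ, hδ, hδ'⟩ := Metric.continuous_iff.1 hg z (1 / (n + 1)) (by positivity)
    have H : ∀ j, ∃ q₁ q₂ : ℚ, (lo₁ j ≤ q₁ ∧ q₁ ≤ hi₁ j ∧ lo₂ j ≤ q₂ ∧ q₂ ≤ hi₂ j) ∧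
        |(q₁ : ℝ) - (z j).re| < δ / 2 ∧ |(q₂ : ℝ) - (z j).im| < δ / 2 := fun j => by
      obtain ⟨h1, h2, h3, h4⟩ := hz j
      obtain ⟨q₁, hq1, hq1', hq1''⟩ := exists_rat_near_mem_Icc h1 h2 (half_pos hδ)
      obtain ⟨q₂, hq2, hq2', hq2''⟩ := exists_rat_near_mem_Icc h3 h4 (half_pos hδ)
      exact ⟨q₁, q₂, ⟨hq1, hq1', hq2, hq2'⟩, hq1'', hq2''⟩
    choose q₁ q₂ hq hq1 hq2 using H
    refine ⟨q₁, q₂, hq, ?_⟩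
    have hd : dist (fun j => (⟨(q₁ j : ℝ), (q₂ j : ℝ)⟩ : ℂ)) z < δ := by
      refine (dist_pi_lt_iff hδ).2 fun j => ?_
      rw [Complex.dist_eq]
      calc ‖(⟨(q₁ j : ℝ), (q₂ j : ℝ)⟩ : ℂ) - z j‖
          ≤ |((⟨(q₁ j : ℝ), (q₂ j : ℝ)⟩ : ℂ) - z j).re| + |((⟨(q₁ j : ℝ), (q₂ j : ℝ)⟩ : ℂ) - z j).im| :=
            Complex.norm_le_abs_re_add_abs_im _
        _ < δ / 2 + δ / 2 := add_lt_add (by simpa using hq1 j) (by simpa using hq2 j)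
        _ = δ := by ring
    have := hδ' _ hd
    rw [hz0, Real.dist_eq, sub_zero, abs_of_nonneg (hg0 _)] at this
    exact this
  · intro h
    choose q₁ q₂ hq using h
    set K : Set (Fin k → ℂ) :=
      {z | ∀ j, (lo₁ j : ℝ) ≤ (z j).re ∧ (z j).re ≤ hi₁ j ∧ (lo₂ j : ℝ) ≤ (z j).im ∧ (z j).im ≤ hi₂ j} with hK
    have hKc : IsCompact K := by
      have e : K = Set.univ.pi (fun j => Icc (lo₁ j : ℝ) (hi₁ j) ×ℂ Icc (lo₂ j : ℝ) (hi₂ j)) := by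
        ext z
        simp only [hK, mem_setOf_eq, mem_univ_pi, Complex.mem_reProdIm, mem_Icc, and_assoc]
      rw [e]
      exact isCompact_univ_pi fun j => isCompact_Icc.reProdIm isCompact_Icc
    have hmem : ∀ n, (fun j => (⟨(q₁ n j : ℝ), (q₂ n j : ℝ)⟩ : ℂ)) ∈ K := fun n => by
      intro j
      obtain ⟨h1, h2, h3, h4⟩ := (hq n).1 j
      exact ⟨show (lo₁ j : ℝ) ≤ (q₁ n j : ℝ) by exact_mod_cast h1, show (q₁ n j : ℝ) ≤ hi₁ j by exact_mod_cast h2,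
        show (lo₂ j : ℝ) ≤ (q₂ n j : ℝ) by exact_mod_cast h3, show (q₂ n j : ℝ) ≤ hi₂ j by exact_mod_cast h4⟩
    obtain ⟨a, haK, φ, hφ, hlim⟩ := hKc.tendsto_subseq hmem
    refine ⟨a, haK, ?_⟩
    have h1 : Tendsto (fun n => g (fun j => (⟨(q₁ (φ n) j : ℝ), (q₂ (φ n) j : ℝ)⟩ : ℂ))) atTop (𝓝 (g a)) :=
      (hg.tendsto a).comp hlim
    have h2 : Tendsto (fun n => g (fun j => (⟨(q₁ (φ n) j : ℝ), (q₂ (φ n) j : ℝ)⟩ : ℂ))) atTop (𝓝 0) := by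
      refine tendsto_of_tendsto_of_tendsto_of_le_of_le tendsto_const_nhds
        (tendsto_one_div_add_atTop_nhds_zero_nat (𝕜 := ℝ)) (fun n => hg0 _) (fun n => ?_)
      exact (hq (φ n)).2.le.trans (Nat.one_div_le_one_div (hφ.id_le n))
    exact tendsto_nhds_unique h1 h2

/-- Finitely many Gaussian rationals over ONE common positive denominator: `q₁ⱼ + q₂ⱼ i = (aⱼ + bⱼ i)/c` with `0 < c`
(take for `c` the product of all denominators). [folklore] -/
theorem exists_int_tuple_eq {k : ℕ} (q₁ q₂ : Fin k → ℚ) :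
    ∃ (c : ℤ) (a b : Fin k → ℤ), 0 < c ∧ (∀ j, (q₁ j : ℝ) = a j / c) ∧ ∀ j, (q₂ j : ℝ) = b j / c := by
  -- a common multiple of all the denominators
  obtain ⟨c, hc, hc₁, hc₂⟩ : ∃ c : ℤ, 0 < c ∧ (∀ j, ((q₁ j).den : ℤ) ∣ c) ∧ ∀ j, ((q₂ j).den : ℤ) ∣ c :=
    ⟨(∏ j, ((q₁ j).den : ℤ)) * ∏ j, ((q₂ j).den : ℤ), by positivity,
      fun j => (Finset.dvd_prod_of_mem (fun j => ((q₁ j).den : ℤ)) (Finset.mem_univ j)).mul_right _,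
      fun j => (Finset.dvd_prod_of_mem (fun j => ((q₂ j).den : ℤ)) (Finset.mem_univ j)).mul_left _⟩
  have key : ∀ q : ℚ, (q.den : ℤ) ∣ c → ∃ a : ℤ, (q : ℝ) = a / c := by
    rintro q ⟨m, hm⟩
    have hm0 : (m : ℝ) ≠ 0 := by
      have : m ≠ 0 := by
        rintro rfl
        rw [mul_zero] at hm
        omega
      exact_mod_cast this
    refine ⟨q.num * m, ?_⟩
    rw [hm]
    push_cast
    rw [mul_div_mul_right _ _ hm0]
    exact_mod_cast (Rat.num_div_den q).symm
  choose a ha using fun j => key (q₁ j) (hc₁ j)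
  choose b hb using fun j => key (q₂ j) (hc₂ j)
  exact ⟨c, a, b, hc, ha, hb⟩

variable [FirstOrder.Ring.CompatibleRing ℤ] {σ : Type*}

/-! ## `∃ z ∈ box ⊆ ℂᵏ, g z = 0` is a ring-definable condition -/

/-- **Zeros in boxes of `ℂᵏ`, first order over `ℤ` (general position).**  Let `g_v : (Fin k → ℂ) → ℝ` (`v ∈ ℤ^σ`) be
continuous and non-negative, with `(v, a, b, c) ↦ g_v (((aⱼ + bⱼ i)/c)ⱼ)` a ring-definable real family (parameters
`σ ⊕ ((Fin k ⊕ Fin k) ⊕ Fin 1)`: `a = w ∘ inr ∘ inl ∘ inl`, `b = w ∘ inr ∘ inl ∘ inr`, `c = w (inr (inr 0))`), and let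
`lo_re j, hi_re j, lo_im j, hi_im j` (`j : Fin k`) and `den` be ring-definable integer functions of `v`.  Then
`{v | 0 < den v ∧ ∃ z ∈ ∏ⱼ [lo_re j/den, hi_re j/den] × [lo_im j/den, hi_im j/den], g_v z = 0}` is ring-definable: by
`exists_zero_in_box_pi_iff` it reads `∀ n ≥ 0, ∃ (a, b, c), 0 < c ∧ (∀ j, corner inequalities, cross-multiplied) ∧
g_v(test tuple) < 1/(n+1)`. [folklore] -/
theorem ringDefinable_setOf_existsZeroInBox_pi {k : ℕ} (g : (σ → ℤ) → (Fin k → ℂ) → ℝ)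
    (hcont : ∀ v, Continuous (g v)) (hnn : ∀ v z, 0 ≤ g v z)
    (hdef : (∅ : Set ℤ).Definable Language.ring {w : _ ⊕ Fin 2 → ℤ | 0 < w (Sum.inr 1) ∧ ((w (Sum.inr 0) : ℤ) : ℝ) < ((w (Sum.inr 1) : ℤ) : ℝ) * ((fun w : σ ⊕ ((Fin k ⊕ Fin k) ⊕ Fin 1) → ℤ => g (fun s => w (Sum.inl s))
      (fun j => ((((w (Sum.inr (Sum.inl (Sum.inl j)))) : ℤ) : ℂ) + (((w (Sum.inr (Sum.inl (Sum.inr j)))) : ℤ) : ℂ) * Complex.I) / (((w (Sum.inr (Sum.inr 0))) : ℤ) : ℂ))) ∘ fun w' s => w' (Sum.inl s)) w})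
    {loRe hiRe loIm hiIm : Fin k → (σ → ℤ) → ℤ} {den : (σ → ℤ) → ℤ}
    (hloRe : ∀ j, (∅ : Set ℤ).DefinableFun Language.ring (loRe j))
    (hhiRe : ∀ j, (∅ : Set ℤ).DefinableFun Language.ring (hiRe j))
    (hloIm : ∀ j, (∅ : Set ℤ).DefinableFun Language.ring (loIm j))
    (hhiIm : ∀ j, (∅ : Set ℤ).DefinableFun Language.ring (hiIm j))
    (hden : (∅ : Set ℤ).DefinableFun Language.ring den) :
    (∅ : Set ℤ).Definable Language.ring {v : σ → ℤ | 0 < den v ∧ ∃ z : Fin k → ℂ,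
      (∀ j : Fin k, ((loRe j v : ℤ) : ℝ) / ((den v : ℤ) : ℝ) ≤ (z j).re ∧ (z j).re ≤ ((hiRe j v : ℤ) : ℝ) / ((den v : ℤ) : ℝ) ∧
        ((loIm j v : ℤ) : ℝ) / ((den v : ℤ) : ℝ) ≤ (z j).im ∧ (z j).im ≤ ((hiIm j v : ℤ) : ℝ) / ((den v : ℤ) : ℝ)) ∧
      g v z = 0} := by
  -- the first-order formula
  have h : (∅ : Set ℤ).Definable Language.ring {v : σ → ℤ | 0 < den v ∧ ∀ n : ℤ, 0 ≤ n →
      ∃ t : (Fin k ⊕ Fin k) ⊕ Fin 1 → ℤ, 0 < t (Sum.inr 0) ∧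
        (∀ j : Fin k, loRe j v * t (Sum.inr 0) ≤ t (Sum.inl (Sum.inl j)) * den v ∧
          t (Sum.inl (Sum.inl j)) * den v ≤ hiRe j v * t (Sum.inr 0) ∧
          loIm j v * t (Sum.inr 0) ≤ t (Sum.inl (Sum.inr j)) * den v ∧
          t (Sum.inl (Sum.inr j)) * den v ≤ hiIm j v * t (Sum.inr 0)) ∧
        g v (fun j => (((t (Sum.inl (Sum.inl j)) : ℤ) : ℂ) + ((t (Sum.inl (Sum.inr j)) : ℤ) : ℂ) * Complex.I) /
          ((t (Sum.inr 0) : ℤ) : ℂ)) < ((1 : ℤ) : ℝ) / ((n + 1 : ℤ) : ℝ)} := by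
    refine definable_setOf_and_params (ringDefinable_setOf_lt ringDefinableFun_zero hden)
      (definable_setOf_forall_params (definable_setOf_imp_params
        (ringDefinable_setOf_nonneg (definableFun_proj_params _))
        (definable_setOf_existsBlock (definable_setOf_and_params
          (ringDefinable_setOf_lt ringDefinableFun_zero (definableFun_proj_params _))
          (definable_setOf_and_params (definable_setOf_forallFin fun j => ?_) ?_)))))
    · have hl₁ := definableFun_reindex (hloRe j) (fun s => (Sum.inl (Sum.inl s) : (σ ⊕ Unit) ⊕ ((Fin k ⊕ Fin k) ⊕ Fin 1)))
      have hh₁ := definableFun_reindex (hhiRe j) (fun s => (Sum.inl (Sum.inl s) : (σ ⊕ Unit) ⊕ ((Fin k ⊕ Fin k) ⊕ Fin 1)))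
      have hl₂ := definableFun_reindex (hloIm j) (fun s => (Sum.inl (Sum.inl s) : (σ ⊕ Unit) ⊕ ((Fin k ⊕ Fin k) ⊕ Fin 1)))
      have hh₂ := definableFun_reindex (hhiIm j) (fun s => (Sum.inl (Sum.inl s) : (σ ⊕ Unit) ⊕ ((Fin k ⊕ Fin k) ⊕ Fin 1)))
      have hd := definableFun_reindex hden (fun s => (Sum.inl (Sum.inl s) : (σ ⊕ Unit) ⊕ ((Fin k ⊕ Fin k) ⊕ Fin 1)))
      exact definable_setOf_and_params
        (ringDefinable_setOf_le (ringDefinableFun_mul hl₁ (definableFun_proj_params _))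
          (ringDefinableFun_mul (definableFun_proj_params _) hd))
        (definable_setOf_and_params
        (ringDefinable_setOf_le (ringDefinableFun_mul (definableFun_proj_params _) hd)
          (ringDefinableFun_mul hh₁ (definableFun_proj_params _)))
        (definable_setOf_and_params
        (ringDefinable_setOf_le (ringDefinableFun_mul hl₂ (definableFun_proj_params _))
          (ringDefinableFun_mul (definableFun_proj_params _) hd))
        (ringDefinable_setOf_le (ringDefinableFun_mul (definableFun_proj_params _) hd)
          (ringDefinableFun_mul hh₂ (definableFun_proj_params _)))))
    · exact ringDefinable_setOf_realLt
        (defR_reindex hdef (Sum.elim (fun s => Sum.inl (Sum.inl s)) Sum.inr))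
        (defR_ratio ringDefinableFun_one (ringDefinableFun_add (definableFun_proj_params _) ringDefinableFun_one))
  convert h using 1
  ext v
  simp only [mem_setOf_eq]
  refine and_congr_right fun hden0 => ?_
  have hden' : (0 : ℝ) < den v := by exact_mod_cast hden0
  -- the box with rational corners
  have key := exists_zero_in_box_pi_iff (hcont v) (hnn v) (fun j => (loRe j v : ℚ) / den v)
    (fun j => (hiRe j v : ℚ) / den v) (fun j => (loIm j v : ℚ) / den v) (fun j => (hiIm j v : ℚ) / den v)
  push_cast at key
  rw [key]
  constructor
  · intro H n hn
    obtain ⟨m, rfl⟩ := Int.eq_ofNat_of_zero_le hn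
    obtain ⟨q₁, q₂, hq, hlt⟩ := H m
    obtain ⟨c, a, b, hc, ha, hb⟩ := exists_int_tuple_eq q₁ q₂
    have hc' : (0 : ℝ) < c := by exact_mod_cast hc
    refine ⟨Sum.elim (Sum.elim a b) (fun _ => c), hc, fun j => ?_, ?_⟩
    · obtain ⟨h1, h2, h3, h4⟩ := hq j
      have h1' : (loRe j v : ℝ) / den v ≤ q₁ j := by exact_mod_cast h1
      have h2' : (q₁ j : ℝ) ≤ hiRe j v / den v := by exact_mod_cast h2
      have h3' : (loIm j v : ℝ) / den v ≤ q₂ j := by exact_mod_cast h3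
      have h4' : (q₂ j : ℝ) ≤ hiIm j v / den v := by exact_mod_cast h4
      rw [ha, div_le_div_iff₀ hden' hc'] at h1'
      rw [ha, div_le_div_iff₀ hc' hden'] at h2'
      rw [hb, div_le_div_iff₀ hden' hc'] at h3'
      rw [hb, div_le_div_iff₀ hc' hden'] at h4'
      simp only [Sum.elim_inl, Sum.elim_inr]
      exact ⟨by exact_mod_cast h1', by exact_mod_cast h2', by exact_mod_cast h3', by exact_mod_cast h4'⟩
    · show g v (fun j => (((a j : ℤ) : ℂ) + ((b j : ℤ) : ℂ) * Complex.I) / ((c : ℤ) : ℂ)) < _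
      simp_rw [testPoint_eq, ← ha, ← hb]
      push_cast
      simpa using hlt
  · intro H m
    obtain ⟨t, ht, hbox, hlt⟩ := H m (Int.natCast_nonneg m)
    have ht' : (0 : ℝ) < t (Sum.inr 0) := by exact_mod_cast ht
    refine ⟨fun j => (t (Sum.inl (Sum.inl j)) : ℚ) / t (Sum.inr 0), fun j => (t (Sum.inl (Sum.inr j)) : ℚ) / t (Sum.inr 0),
      fun j => ?_, ?_⟩
    · obtain ⟨h1, h2, h3, h4⟩ := hbox j
      refine ⟨?_, ?_, ?_, ?_⟩
      · have : (loRe j v : ℝ) * t (Sum.inr 0) ≤ t (Sum.inl (Sum.inl j)) * den v := by exact_mod_cast h1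
        have : (loRe j v : ℝ) / den v ≤ t (Sum.inl (Sum.inl j)) / t (Sum.inr 0) := by
          rw [div_le_div_iff₀ hden' ht']; linarith
        exact_mod_cast this
      · have : (t (Sum.inl (Sum.inl j)) : ℝ) * den v ≤ hiRe j v * t (Sum.inr 0) := by exact_mod_cast h2
        have : (t (Sum.inl (Sum.inl j)) : ℝ) / t (Sum.inr 0) ≤ hiRe j v / den v := by
          rw [div_le_div_iff₀ ht' hden']; linarith
        exact_mod_cast this
      · have : (loIm j v : ℝ) * t (Sum.inr 0) ≤ t (Sum.inl (Sum.inr j)) * den v := by exact_mod_cast h3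
        have : (loIm j v : ℝ) / den v ≤ t (Sum.inl (Sum.inr j)) / t (Sum.inr 0) := by
          rw [div_le_div_iff₀ hden' ht']; linarith
        exact_mod_cast this
      · have : (t (Sum.inl (Sum.inr j)) : ℝ) * den v ≤ hiIm j v * t (Sum.inr 0) := by exact_mod_cast h4
        have : (t (Sum.inl (Sum.inr j)) : ℝ) / t (Sum.inr 0) ≤ hiIm j v / den v := by
          rw [div_le_div_iff₀ ht' hden']; linarith
        exact_mod_cast this
    · simp_rw [testPoint_eq] at hlt
      push_cast at hlt ⊢
      simpa using hlt

/-! ## Registered form -/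

omit [FirstOrder.Ring.CompatibleRing ℤ] in
set_option linter.unusedVariables false in -- the registered signature names the instance binder `inst`
/-- Registered helper stub `stub_existsZeroInBox_pi` of crux stmt-Schanuel-0969 (line kernel-arithmetic-selection):
**"a continuous non-negative function on `ℂᵏ` has a zero in a closed rational box" is first-order over `ℤ`**: if the
values `g_v(((aⱼ + bⱼ i)/c)ⱼ)` at Gaussian-rational test tuples with one common denominator have a ring-definable strict
lower rational cut in `(v, a, b, c, p, r)`, then the set of `(v, lo_re, hi_re, lo_im, hi_im, den) ∈ ℤ^s × ℤ^{4k+1}` with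
`0 < den` such that `g_v` vanishes somewhere in the closed box `∏ⱼ [lo_re j/den, hi_re j/den] × [lo_im j/den, hi_im j/den]`
is ring-definable (compactness + density of `ℚ[i]ᵏ`; `ringDefinable_setOf_existsZeroInBox_pi` with the box data read off
as coordinate projections). [folklore] -/
theorem stub_existsZeroInBox_pi : ∀ [inst : FirstOrder.Ring.CompatibleRing ℤ] (s k : ℕ) (g : (Fin s → ℤ) → (Fin k → ℂ) → ℝ), (∀ v, Continuous (g v)) → (∀ v z, 0 ≤ g v z) → (∅ : Set ℤ).Definable FirstOrder.Language.ring {w : (Fin s ⊕ ((Fin k ⊕ Fin k) ⊕ Fin 1)) ⊕ Fin 2 → ℤ | 0 < w (Sum.inr 1) ∧ ((w (Sum.inr 0) : ℤ) : ℝ) < ((w (Sum.inr 1) : ℤ) : ℝ) * g (fun i => w (Sum.inl (Sum.inl i))) (fun j => ((((w (Sum.inl (Sum.inr (Sum.inl (Sum.inl j))))) : ℤ) : ℂ) + (((w (Sum.inl (Sum.inr (Sum.inl (Sum.inr j))))) : ℤ) : ℂ) * Complex.I) / (((w (Sum.inl (Sum.inr (Sum.inr 0)))) : ℤ) : ℂ))}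 → (∅ : Set ℤ).Definable FirstOrder.Language.ring {u : Fin s ⊕ (((Fin k ⊕ Fin k) ⊕ (Fin k ⊕ Fin k)) ⊕ Fin 1) → ℤ | 0 < u (Sum.inr (Sum.inr 0)) ∧ ∃ z : Fin k → ℂ, (∀ j : Fin k, (((u (Sum.inr (Sum.inl (Sum.inl (Sum.inl j))))) : ℤ) : ℝ) / (((u (Sum.inr (Sum.inr 0))) : ℤ) : ℝ) ≤ (z j).re ∧ (z j).re ≤ (((u (Sum.inr (Sum.inl (Sum.inl (Sum.inr j))))) : ℤ) : ℝ) / (((u (Sum.inr (Sum.inr 0))) : ℤ) : ℝ) ∧ (((u (Sum.inr (Sum.inl (Sum.inr (Sum.inl j))))) : ℤ) : ℝ) / (((u (Sum.inr (Sum.inr 0))) : ℤ) : ℝ) ≤ (z j).im ∧ (z j).im ≤ (((u (Sum.inr (Sum.inl (Sum.inr (Sum.inr j))))) : ℤ) : ℝ) / (((u (Sum.inr (Sum.inr 0))) : ℤ) : ℝ)) ∧ g (fun i => u (Sum.inl i)) z = 0} := by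
  intro _ s k g hcont hnn hdef
  have hdef' : (∅ : Set ℤ).Definable Language.ring {w : _ ⊕ Fin 2 → ℤ | 0 < w (Sum.inr 1) ∧ ((w (Sum.inr 0) : ℤ) : ℝ) < ((w (Sum.inr 1) : ℤ) : ℝ) * ((fun w : Fin s ⊕ ((Fin k ⊕ Fin k) ⊕ Fin 1) → ℤ => g (fun i => w (Sum.inl i))
      (fun j => ((((w (Sum.inr (Sum.inl (Sum.inl j)))) : ℤ) : ℂ) + (((w (Sum.inr (Sum.inl (Sum.inr j)))) : ℤ) : ℂ) * Complex.I) / (((w (Sum.inr (Sum.inr 0))) : ℤ) : ℂ))) ∘ fun w' s => w' (Sum.inl s)) w} :=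
    hdef
  exact ringDefinable_setOf_existsZeroInBox_pi (σ := Fin s ⊕ (((Fin k ⊕ Fin k) ⊕ (Fin k ⊕ Fin k)) ⊕ Fin 1))
    (fun u z => g (fun i => u (Sum.inl i)) z) (fun u => hcont _) (fun u z => hnn _ z)
    (defR_reindex hdef' (Sum.map Sum.inl id))
    (fun j => definableFun_proj_params (Sum.inr (Sum.inl (Sum.inl (Sum.inl j)))))
    (fun j => definableFun_proj_params (Sum.inr (Sum.inl (Sum.inl (Sum.inr j)))))
    (fun j => definableFun_proj_params (Sum.inr (Sum.inl (Sum.inr (Sum.inl j)))))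
    (fun j => definableFun_proj_params (Sum.inr (Sum.inl (Sum.inr (Sum.inr j)))))
    (definableFun_proj_params (Sum.inr (Sum.inr 0)))

end Summit.Schanuel.Schanuel.Cruxes.MinimalCounterexampleInAcl.KernelArithmeticSelection
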